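import Summits.Ventures.PercRepro.C041BlockMapSubdiv

/-!
# ROW C-041 — THE WEDGE OF TWO HOSTS AT THEIR ANCHORS: the construction, its paths and the statuses of its
vertices (p6, gen 34; part 1 of THEOREM (WEDGE), the theorem itself is `C041BlockMapWedge`)

Setting of `C041BlockMapMultilinear` / `C041BlockMapSubdiv`.  The WEDGE `wedge Za Zb a₁ a₂` of two unmarked hosts at their anchors has the
vertices `V₁ ⊕ V₂` and the edges `E₁ ⊕ E₂`, every end of an edge of `Zb` REDIRECTED by `redW` (`a₂ ↦ inl a₁`,
`y ↦ inr y` otherwise); its anchor is `inl a₁`, its exits `Sum.elim (inl ∘ u₁) (redW ∘ u₂)`.  A monochromatic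
path of the wedge between two vertices of one side is a path of that side, and one between the sides passes
through the anchor (`reflTransGen_wedge_left_iff`, `reflTransGen_wedge_left_right_iff`,
`reflTransGen_wedge_right_iff`): so every exit has the status it has on its own side, the merged set and the
blocks split by side (`merged_wedge`, `blocks_wedge`), the colouring term of `(ω₁, ω₂)` is the product of the two
colouring terms (`colTerm_wedge`), and **`blockMap_wedge`: the block map of the wedge at `w` is the product of the
block maps of the two hosts at `w ∘ inl` and `w ∘ inr`**.  COROLLARY (`inCone_blockMap_wedge`): the cone
conjecture for block maps is closed under wedging at the anchor (the cone is closed under products); with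
THEOREM (SUBDIVISION) and the reductions, CONJECTURE (BLOCK MAP) for every host follows from the hosts that are
2-connected at the anchor with every non-terminal vertex of degree `≥ 3`.
-/

namespace PercRepro

namespace ZoneZ

namespace MultiExit

open ZoneData Pendant Finset TwoExit TreeClosure

variable {V₁ E₁ U₁ W₁ V₂ E₂ U₂ W₂ : Type} (Za : ZoneData V₁ E₁ U₁ W₁) (Zb : ZoneData V₂ E₂ U₂ W₂)
  (a₁ : V₁) (a₂ : V₂) [DecidableEq V₂]

/-! ## The wedge -/

/-- The redirection of the vertices of `Zb`: the anchor `a₂` goes to `inl a₁`, every other vertex to `inr`. -/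
def redW (y : V₂) : V₁ ⊕ V₂ := if y = a₂ then Sum.inl a₁ else Sum.inr y

/-- The redirection of the anchor. -/
theorem redW_anchor : redW a₁ a₂ a₂ = Sum.inl a₁ := by
  unfold redW
  rw [if_pos rfl]

/-- The redirection of a non-anchor vertex. -/
theorem redW_of_ne {y : V₂} (h : y ≠ a₂) : redW a₁ a₂ y = Sum.inr y := by
  unfold redW
  rw [if_neg h]

/-- A redirected vertex in the left side is the anchor. -/
theorem eq_of_redW_eq_inl {y : V₂} {x : V₁} (h : redW a₁ a₂ y = Sum.inl x) : y = a₂ ∧ x = a₁ := by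
  by_cases hy : y = a₂
  · subst hy
    rw [redW_anchor] at h
    exact ⟨rfl, (Sum.inl.inj h).symm⟩
  · rw [redW_of_ne a₁ a₂ hy] at h
    exact absurd h Sum.inr_ne_inl

/-- A redirected vertex in the right side is not the anchor, and is itself. -/
theorem eq_of_redW_eq_inr {y y' : V₂} (h : redW a₁ a₂ y = Sum.inr y') : y ≠ a₂ ∧ y = y' := by
  by_cases hy : y = a₂
  · subst hy
    rw [redW_anchor] at h
    exact absurd h Sum.inl_ne_inr
  · rw [redW_of_ne a₁ a₂ hy] at h
    exact ⟨hy, Sum.inr.inj h⟩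

/-- The WEDGE of two hosts at their anchors. -/
def wedge : ZoneData (V₁ ⊕ V₂) (E₁ ⊕ E₂) (U₁ ⊕ U₂) (W₁ ⊕ W₂) where
  fst := fun e => match e with
    | Sum.inl e => Sum.inl (Za.fst e)
    | Sum.inr e => redW a₁ a₂ (Zb.fst e)
  snd := fun e => match e with
    | Sum.inl e => Sum.inl (Za.snd e)
    | Sum.inr e => redW a₁ a₂ (Zb.snd e)
  at₁ := fun t => match t with
    | Sum.inl t => Sum.inl (Za.at₁ t)
    | Sum.inr t => redW a₁ a₂ (Zb.at₁ t)
  at₂ := fun t => match t with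
    | Sum.inl t => Sum.inl (Za.at₂ t)
    | Sum.inr t => redW a₁ a₂ (Zb.at₂ t)

/-- `Joins` of a left edge. -/
theorem wedge_joins_inl (e : E₁) (z z' : V₁ ⊕ V₂) :
    (wedge Za Zb a₁ a₂).Joins (Sum.inl e) z z' ↔ ∃ x x', z = Sum.inl x ∧ z' = Sum.inl x' ∧ Za.Joins e x x' := by
  unfold Joins
  show (Sum.inl (Za.fst e) = z ∧ Sum.inl (Za.snd e) = z') ∨ (Sum.inl (Za.fst e) = z' ∧ Sum.inl (Za.snd e) = z) ↔ _
  constructor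
  · rintro (⟨h1, h2⟩ | ⟨h1, h2⟩)
    · exact ⟨_, _, h1.symm, h2.symm, Or.inl ⟨rfl, rfl⟩⟩
    · exact ⟨_, _, h2.symm, h1.symm, Or.inr ⟨rfl, rfl⟩⟩
  · rintro ⟨x, x', rfl, rfl, (⟨rfl, rfl⟩ | ⟨rfl, rfl⟩)⟩
    · exact Or.inl ⟨rfl, rfl⟩
    · exact Or.inr ⟨rfl, rfl⟩

/-- `Joins` of a right edge: the redirected ends. -/
theorem wedge_joins_inr (e : E₂) (z z' : V₁ ⊕ V₂) :
    (wedge Za Zb a₁ a₂).Joins (Sum.inr e) z z' ↔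
      ∃ y y', z = redW a₁ a₂ y ∧ z' = redW a₁ a₂ y' ∧ Zb.Joins e y y' := by
  unfold Joins
  show (redW a₁ a₂ (Zb.fst e) = z ∧ redW a₁ a₂ (Zb.snd e) = z') ∨
    (redW a₁ a₂ (Zb.fst e) = z' ∧ redW a₁ a₂ (Zb.snd e) = z) ↔ _
  constructor
  · rintro (⟨h1, h2⟩ | ⟨h1, h2⟩)
    · exact ⟨_, _, h1.symm, h2.symm, Or.inl ⟨rfl, rfl⟩⟩
    · exact ⟨_, _, h2.symm, h1.symm, Or.inr ⟨rfl, rfl⟩⟩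
  · rintro ⟨y, y', rfl, rfl, (⟨rfl, rfl⟩ | ⟨rfl, rfl⟩)⟩
    · exact Or.inl ⟨rfl, rfl⟩
    · exact Or.inr ⟨rfl, rfl⟩

/-! ## Paths of the wedge -/

section Reach

variable (c : Bool) (ω : E₁ ⊕ E₂ → Bool)

/-- A left step lifts to the wedge. -/
theorem cAdj_wedge_of_left {x x' : V₁} (h : cAdj Za c (fun e => ω (Sum.inl e)) x x') :
    cAdj (wedge Za Zb a₁ a₂) c ω (Sum.inl x) (Sum.inl x') := by
  obtain ⟨e, he, hc⟩ := h
  exact ⟨Sum.inl e, (wedge_joins_inl Za Zb a₁ a₂ e _ _).2 ⟨x, x', rfl, rfl, he⟩, hc⟩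

/-- A right step lifts to the wedge, redirected. -/
theorem cAdj_wedge_of_right {y y' : V₂} (h : cAdj Zb c (fun e => ω (Sum.inr e)) y y') :
    cAdj (wedge Za Zb a₁ a₂) c ω (redW a₁ a₂ y) (redW a₁ a₂ y') := by
  obtain ⟨e, he, hc⟩ := h
  exact ⟨Sum.inr e, (wedge_joins_inr Za Zb a₁ a₂ e _ _).2 ⟨y, y', rfl, rfl, he⟩, hc⟩

/-- A left path lifts to the wedge. -/
theorem reflTransGen_wedge_of_left {x x' : V₁}
    (h : Relation.ReflTransGen (cAdj Za c fun e => ω (Sum.inl e)) x x') :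
    Relation.ReflTransGen (cAdj (wedge Za Zb a₁ a₂) c ω) (Sum.inl x) (Sum.inl x') := by
  induction h with
  | refl => exact Relation.ReflTransGen.refl
  | tail _ hstep ih => exact ih.tail (cAdj_wedge_of_left Za Zb a₁ a₂ c ω hstep)

/-- A right path lifts to the wedge, redirected. -/
theorem reflTransGen_wedge_of_right {y y' : V₂}
    (h : Relation.ReflTransGen (cAdj Zb c fun e => ω (Sum.inr e)) y y') :
    Relation.ReflTransGen (cAdj (wedge Za Zb a₁ a₂) c ω) (redW a₁ a₂ y) (redW a₁ a₂ y') := by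
  induction h with
  | refl => exact Relation.ReflTransGen.refl
  | tail _ hstep ih => exact ih.tail (cAdj_wedge_of_right Za Zb a₁ a₂ c ω hstep)

/-- **The reach of a left vertex in the wedge**: a left vertex is reached through the left side; a right vertex
through the anchor — the left side to `a₁`, then the right side from `a₂`. -/
theorem reach_wedge_left (x : V₁) :
    ∀ z, Relation.ReflTransGen (cAdj (wedge Za Zb a₁ a₂) c ω) (Sum.inl x) z →
      (∀ x', z = Sum.inl x' → Relation.ReflTransGen (cAdj Za c fun e => ω (Sum.inl e)) x x') ∧
      (∀ y, z = Sum.inr y → y ≠ a₂ ∧ Relation.ReflTransGen (cAdj Za c fun e => ω (Sum.inl e)) x a₁ ∧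
        Relation.ReflTransGen (cAdj Zb c fun e => ω (Sum.inr e)) a₂ y) := by
  intro z hz
  induction hz with
  | refl =>
    refine ⟨fun x' hx' => ?_, fun y hy => (nomatch hy)⟩
    cases hx'
    exact Relation.ReflTransGen.refl
  | tail hpath hstep ih =>
    obtain ⟨e, hj, hc⟩ := hstep
    rcases e with e | e
    · rw [wedge_joins_inl] at hj
      obtain ⟨x₁, x₂, rfl, rfl, hxx⟩ := hj
      refine ⟨fun x' hx' => ?_, fun y hy => (nomatch hy)⟩
      cases hx'
      exact (ih.1 x₁ rfl).tail ⟨e, hxx, hc⟩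
    · rw [wedge_joins_inr] at hj
      obtain ⟨y₁, y₂, hz, hz', hyy⟩ := hj
      have hstep' : cAdj Zb c (fun e => ω (Sum.inr e)) y₁ y₂ := ⟨e, hyy, hc⟩
      subst hz hz'
      refine ⟨fun x' hx' => ?_, fun y hy => ?_⟩
      · -- the target is a left vertex: it is the anchor, reached from `y₁ = a₂` or from a right vertex
        obtain ⟨-, hx'⟩ := eq_of_redW_eq_inl a₁ a₂ hx'
        rw [hx']
        by_cases hy₁ : y₁ = a₂
        · rw [hy₁, redW_anchor] at ih
          exact ih.1 a₁ rfl
        · rw [redW_of_ne a₁ a₂ hy₁] at ih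
          exact (ih.2 y₁ rfl).2.1
      · obtain ⟨hy₂, rfl⟩ := eq_of_redW_eq_inr a₁ a₂ hy
        refine ⟨hy₂, ?_, ?_⟩
        · by_cases hy₁ : y₁ = a₂
          · rw [hy₁, redW_anchor] at ih
            exact ih.1 a₁ rfl
          · rw [redW_of_ne a₁ a₂ hy₁] at ih
            exact (ih.2 y₁ rfl).2.1
        · by_cases hy₁ : y₁ = a₂
          · rw [hy₁] at hstep'
            exact Relation.ReflTransGen.single hstep'
          · rw [redW_of_ne a₁ a₂ hy₁] at ih
            exact (ih.2 y₁ rfl).2.2.tail hstep'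

/-- **The reach of a right vertex in the wedge**: a right vertex is reached through the right side; a left vertex
through the anchor — the right side to `a₂`, then the left side from `a₁`. -/
theorem reach_wedge_right (y₀ : V₂) :
    ∀ z, Relation.ReflTransGen (cAdj (wedge Za Zb a₁ a₂) c ω) (Sum.inr y₀) z →
      (∀ y, z = Sum.inr y → Relation.ReflTransGen (cAdj Zb c fun e => ω (Sum.inr e)) y₀ y) ∧
      (∀ x, z = Sum.inl x → Relation.ReflTransGen (cAdj Zb c fun e => ω (Sum.inr e)) y₀ a₂ ∧
        Relation.ReflTransGen (cAdj Za c fun e => ω (Sum.inl e)) a₁ x) := by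
  intro z hz
  induction hz with
  | refl =>
    refine ⟨fun y hy => ?_, fun x hx => (nomatch hx)⟩
    cases hy
    exact Relation.ReflTransGen.refl
  | tail hpath hstep ih =>
    obtain ⟨e, hj, hc⟩ := hstep
    rcases e with e | e
    · rw [wedge_joins_inl] at hj
      obtain ⟨x₁, x₂, rfl, rfl, hxx⟩ := hj
      refine ⟨fun y hy => (nomatch hy), fun x hx => ?_⟩
      cases hx
      exact ⟨(ih.2 x₁ rfl).1, (ih.2 x₁ rfl).2.tail ⟨e, hxx, hc⟩⟩
    · rw [wedge_joins_inr] at hj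
      obtain ⟨y₁, y₂, hz, hz', hyy⟩ := hj
      have hstep' : cAdj Zb c (fun e => ω (Sum.inr e)) y₁ y₂ := ⟨e, hyy, hc⟩
      subst hz hz'
      -- the source end `y₁`: either the anchor (then `y₀ ~ a₂` from the left clause) or a right vertex
      have hy₁path : Relation.ReflTransGen (cAdj Zb c fun e => ω (Sum.inr e)) y₀ y₁ := by
        by_cases hy₁ : y₁ = a₂
        · rw [hy₁, redW_anchor] at ih
          rw [hy₁]
          exact (ih.2 a₁ rfl).1
        · rw [redW_of_ne a₁ a₂ hy₁] at ih
          exact ih.1 y₁ rfl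
      refine ⟨fun y hy => ?_, fun x hx => ?_⟩
      · obtain ⟨-, rfl⟩ := eq_of_redW_eq_inr a₁ a₂ hy
        exact hy₁path.tail hstep'
      · obtain ⟨hy₂, hx⟩ := eq_of_redW_eq_inl a₁ a₂ hx
        rw [hx]
        rw [hy₂] at hstep'
        exact ⟨hy₁path.tail hstep', Relation.ReflTransGen.refl⟩

/-- Paths between left vertices. -/
theorem reflTransGen_wedge_left_iff (x x' : V₁) :
    Relation.ReflTransGen (cAdj (wedge Za Zb a₁ a₂) c ω) (Sum.inl x) (Sum.inl x') ↔
      Relation.ReflTransGen (cAdj Za c fun e => ω (Sum.inl e)) x x' :=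
  ⟨fun h => (reach_wedge_left Za Zb a₁ a₂ c ω x _ h).1 x' rfl, reflTransGen_wedge_of_left Za Zb a₁ a₂ c ω⟩

/-- Paths from a left vertex to a redirected right vertex. -/
theorem reflTransGen_wedge_left_red_iff (x : V₁) (y : V₂) :
    Relation.ReflTransGen (cAdj (wedge Za Zb a₁ a₂) c ω) (Sum.inl x) (redW a₁ a₂ y) ↔
      Relation.ReflTransGen (cAdj Za c fun e => ω (Sum.inl e)) x a₁ ∧
        Relation.ReflTransGen (cAdj Zb c fun e => ω (Sum.inr e)) a₂ y := by
  by_cases hy : y = a₂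
  · rw [hy, redW_anchor, reflTransGen_wedge_left_iff]
    exact ⟨fun h => ⟨h, Relation.ReflTransGen.refl⟩, fun h => h.1⟩
  · rw [redW_of_ne a₁ a₂ hy]
    constructor
    · intro h
      exact ((reach_wedge_left Za Zb a₁ a₂ c ω x _ h).2 y rfl).2
    · rintro ⟨h1, h2⟩
      have := (reflTransGen_wedge_of_left Za Zb a₁ a₂ c ω h1).trans
        (redW_anchor a₁ a₂ ▸ reflTransGen_wedge_of_right Za Zb a₁ a₂ c ω h2)
      rwa [redW_of_ne a₁ a₂ hy] at this

/-- Paths between redirected right vertices. -/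
theorem reflTransGen_wedge_red_iff (y y' : V₂) :
    Relation.ReflTransGen (cAdj (wedge Za Zb a₁ a₂) c ω) (redW a₁ a₂ y) (redW a₁ a₂ y') ↔
      Relation.ReflTransGen (cAdj Zb c fun e => ω (Sum.inr e)) y y' := by
  constructor
  · intro h
    by_cases hy : y = a₂
    · rw [hy, redW_anchor] at h
      rw [hy]
      exact ((reflTransGen_wedge_left_red_iff Za Zb a₁ a₂ c ω a₁ y').1 h).2
    · rw [redW_of_ne a₁ a₂ hy] at h
      by_cases hy' : y' = a₂
      · rw [hy', redW_anchor] at h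
        rw [hy']
        exact ((reach_wedge_right Za Zb a₁ a₂ c ω y _ h).2 a₁ rfl).1
      · rw [redW_of_ne a₁ a₂ hy'] at h
        exact (reach_wedge_right Za Zb a₁ a₂ c ω y _ h).1 y' rfl
  · exact reflTransGen_wedge_of_right Za Zb a₁ a₂ c ω

end Reach

/-! ## The statuses of the exits -/

section Statuses

variable (ω : E₁ ⊕ E₂ → Bool)

/-- Merged status between left vertices. -/
theorem Mg_wedge_inl (x x' : V₁) :
    (wedge Za Zb a₁ a₂).Mg (Sum.inl x) (Sum.inl x') ω ↔ Za.Mg x x' fun e => ω (Sum.inl e) := by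
  rw [Mg_iff_reflTransGen, Mg_iff_reflTransGen]
  exact reflTransGen_wedge_left_iff Za Zb a₁ a₂ false ω x x'

/-- Reached status between left vertices. -/
theorem Rd_wedge_inl (x x' : V₁) :
    (wedge Za Zb a₁ a₂).Rd (Sum.inl x) (Sum.inl x') ω ↔ Za.Rd x x' fun e => ω (Sum.inl e) := by
  rw [Rd_iff_reflTransGen, Rd_iff_reflTransGen]
  exact reflTransGen_wedge_left_iff Za Zb a₁ a₂ true ω x x'

/-- Merged status from a left vertex to a redirected right vertex: through the anchor. -/
theorem Mg_wedge_inl_red (x : V₁) (y : V₂) :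
    (wedge Za Zb a₁ a₂).Mg (Sum.inl x) (redW a₁ a₂ y) ω ↔
      Za.Mg x a₁ (fun e => ω (Sum.inl e)) ∧ Zb.Mg a₂ y fun e => ω (Sum.inr e) := by
  rw [Mg_iff_reflTransGen, Mg_iff_reflTransGen, Mg_iff_reflTransGen]
  exact reflTransGen_wedge_left_red_iff Za Zb a₁ a₂ false ω x y

/-- Reached status from a left vertex to a redirected right vertex: through the anchor. -/
theorem Rd_wedge_inl_red (x : V₁) (y : V₂) :
    (wedge Za Zb a₁ a₂).Rd (Sum.inl x) (redW a₁ a₂ y) ω ↔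
      Za.Rd x a₁ (fun e => ω (Sum.inl e)) ∧ Zb.Rd a₂ y fun e => ω (Sum.inr e) := by
  rw [Rd_iff_reflTransGen, Rd_iff_reflTransGen, Rd_iff_reflTransGen]
  exact reflTransGen_wedge_left_red_iff Za Zb a₁ a₂ true ω x y

/-- Merged status between redirected right vertices. -/
theorem Mg_wedge_red (y y' : V₂) :
    (wedge Za Zb a₁ a₂).Mg (redW a₁ a₂ y) (redW a₁ a₂ y') ω ↔ Zb.Mg y y' fun e => ω (Sum.inr e) := by
  rw [Mg_iff_reflTransGen, Mg_iff_reflTransGen]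
  exact reflTransGen_wedge_red_iff Za Zb a₁ a₂ false ω y y'

/-- Merged status from the anchor to a left exit. -/
theorem Mg_wedge_anchor_inl (x : V₁) :
    (wedge Za Zb a₁ a₂).Mg (Sum.inl a₁) (Sum.inl x) ω ↔ Za.Mg a₁ x fun e => ω (Sum.inl e) :=
  Mg_wedge_inl Za Zb a₁ a₂ ω a₁ x

/-- Merged status from the anchor to a redirected right exit. -/
theorem Mg_wedge_anchor_red (y : V₂) :
    (wedge Za Zb a₁ a₂).Mg (Sum.inl a₁) (redW a₁ a₂ y) ω ↔ Zb.Mg a₂ y fun e => ω (Sum.inr e) := by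
  rw [Mg_wedge_inl_red]
  exact ⟨fun h => h.2, fun h => ⟨Mg_refl Za _ a₁, h⟩⟩

/-- Reached status from the anchor to a left exit. -/
theorem Rd_wedge_anchor_inl (x : V₁) :
    (wedge Za Zb a₁ a₂).Rd (Sum.inl a₁) (Sum.inl x) ω ↔ Za.Rd a₁ x fun e => ω (Sum.inl e) :=
  Rd_wedge_inl Za Zb a₁ a₂ ω a₁ x

/-- Reached status from the anchor to a redirected right exit. -/
theorem Rd_wedge_anchor_red (y : V₂) :
    (wedge Za Zb a₁ a₂).Rd (Sum.inl a₁) (redW a₁ a₂ y) ω ↔ Zb.Rd a₂ y fun e => ω (Sum.inr e) := by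
  rw [Rd_wedge_inl_red]
  exact ⟨fun h => h.2, fun h => ⟨(Rd_iff_reflTransGen Za a₁ a₁ _).2 Relation.ReflTransGen.refl, h⟩⟩

/-- Merged status from a redirected right vertex to a left vertex: through the anchor. -/
theorem Mg_wedge_red_inl (y : V₂) (x : V₁) :
    (wedge Za Zb a₁ a₂).Mg (redW a₁ a₂ y) (Sum.inl x) ω ↔
      Za.Mg x a₁ (fun e => ω (Sum.inl e)) ∧ Zb.Mg a₂ y fun e => ω (Sum.inr e) := by
  rw [← Mg_wedge_inl_red]
  exact ⟨Mg_symm _ ω _ _, Mg_symm _ ω _ _⟩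

end Statuses

end MultiExit

end ZoneZ

end PercRepro
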